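import Summits.ResolutionOfSingularities.ResolutionOfSingularities.Theorems.WeightedInvariantHypersurfaceCentreAssemblyRegularOfPresentation
import Summits.ResolutionOfSingularities.ResolutionOfSingularities.Theorems.WeightedInvariantHypersurfaceCentreAssemblyMaxLocus
import Summits.ResolutionOfSingularities.ResolutionOfSingularities.Theorems.WeightedInvariantHypersurfaceLocalGameEFT4S
import HarnessLib

/-!
# Door assembly H2c″ — sub-stub [S4] `stub_isRegularWeightedCentre_of_isCanonicalCentre` BY NAME

Route `ResolutionOfSingularities/WeightedInvariant`, crux `Theses.WeightedInvariant.HypersurfaceCentreConstruction`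
(stmt-ResolutionOfSingularities-19897), door line `local-engine`, skeleton v3.1 (`door_local_engine_v31.lean` 6182e6a42f97ef87,
res-L1-w43-plan-1), stub [S4] (res-L1-w43-stub-9 = res-D-brk-1), signature VERBATIM as registered (`p`, `ι`, `J` section variables).

The canonical centre `R` of a singular hypersurface pair `(Y → Spec k, X)` is a REGULAR WEIGHTED CENTRE (Włodarczyk 2.1.10).
Proof = `isRegularWeightedCentre_of_isCanonicalCentre_of_forallPresentation` (p505837: instantiation of the ∀-model
stratum-exact open presentation (open″) `JOpenPresentationForallSing` at the principal charts of `X`, the bridge p504102 and the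
chart criterion p502377) with the closedness of the maximum locus from [S1] `stub_maxLocus` (res-type-057, p504597).  The
hypotheses `hgame` (the game clause) is carried by the registered shape but idle here ([S4] consumes (c6), (c8), (c12a), `J`
iso-invariance and (open″) only).  OURS; AI-written, weaker than expert review; no claim about Hironaka's problem.
-/

noncomputable section

set_option linter.dupNamespace false -- mandated namespace of this single-conjunct summit

open CategoryTheory AlgebraicGeometry TopologicalSpace IsLocalRing
open Literature.AlgebraicGeometry.Resolution
open Summit.ResolutionOfSingularities.ResolutionOfSingularities.Theorems

namespace Summit.ResolutionOfSingularities.ResolutionOfSingularities.Cruxes.HypersurfaceCentreConstruction.LocalEngine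

variable {p : ℕ} (ι : (R : Type) → [CommRing R] → R → Ordinal.{0})
  (J : (R : Type) → [CommRing R] → R → ℕ → Ideal R)

/-- **[S4] of door skeleton v3.1, BY NAME: the canonical centre is a regular weighted centre.**  For `ι`, `J` with (c6), (c8),
(c12a), `J` iso- and unit-invariant, the game clause (c9′) and the ∀-model stratum-exact open presentation (open″), a smooth separated
quasi-compact `f : Y → Spec k` over a perfect field of characteristic `p`, a locally principal `X` with `V(X)` integral and not
regular, and a canonical centre `R` of `(Y, X)`: `R.IsRegularWeightedCentre`. [cite: Wlodarczyk2022, 2.1.10] -/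
theorem stub_isRegularWeightedCentre_of_isCanonicalCentre (hc6 : IotaIsoInvariant ι) (hc8 : IotaUpperSemicontinuous ι)
    (hu : IotaUnitInvariant ι) (hJ : JIsoInvariant J) (hJu : JUnitInvariant J) (hgame : CanonicalGameClause p ι J)
    (hopen : JOpenPresentationForallSing p ι J) {k : Type} [Field k] [CharP k p] [PerfectField k] {Y : Scheme.{0}}
    (f : Y ⟶ Spec (.of k)) [Smooth f] [IsSeparated f] [QuasiCompact f] (X : Y.IdealSheafData) (hX : IsLocallyPrincipal X)
    (hXi : IsIntegral X.subscheme) (hsing : ¬ Scheme.IsRegular X.subscheme) (R : ReesAlgebraData Y)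
    (hR : IsCanonicalCentre ι J X R) : R.IsRegularWeightedCentre :=
  have _unused : CanonicalGameClause p ι J := hgame
  isRegularWeightedCentre_of_isCanonicalCentre_of_forallPresentation ι J hc6 hu hJ hJu hopen f X hX R hR
    (stub_maxLocus (p := p) ι hc6 hc8 hu f X hX hXi hsing).1

end Summit.ResolutionOfSingularities.ResolutionOfSingularities.Cruxes.HypersurfaceCentreConstruction.LocalEngine

end
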